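/-
Copyright (c) 2026 the pub-hodgecm-mathlib formalisation cell (harness21).  Prover seat hodgecm-mathlib-LH7-p07 (g2) on the CHAIR K2-lead VALVE,
Track B «K2-LIT» ∕ hLiu418 #184♮ = `stmt-HodgeConjecture-24832`, Road I v3 U5 «THE CLOSE» — FACE-G organ (G-gen) = F4, road (E), B3-b FILE 1
(LEAD F0P6-plan (g14) BATCH #152 (1) ∕ #158; F4 lead K2Liu-p27 (g2) DESIGN OF RECORD 2026-09-04T23:26:22Z «polynomial-slot tuples»; box K2-defs1 ∕ K2E5-r02 (g6)).
DEF LANE: five definitions (`tuplePoly`, `tupleRest`, `tupleVecOf`, `frameSlotEquiv`, `frameSlot`) + kernel API.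
-/
import Summits.HodgeConjecture.HodgeConjecture.Theorems.K2LiuArchWeilJunctionTransport     -- ★ J2c: the one-place frame chain `𝒥_σ` of the BIG datum (+ ★ W4, `placeSecJ`, `tensorPi`, `unitJunctionIdx`)
import Literature.RepresentationTheory.KonnoKonno2007.JunctionSwapBargmann                 -- ★ `schwartzTransport_relabelCLE_binvPi` (`B⁻¹` along a relabelling)
import Literature.Analysis.SegalBargmann.SchwartzTensorPiBargmann                          -- ★ `binvPi_rename_mul` (`B⁻¹` is multiplicative on separate variables)
import Literature.NumberTheory.GelbartRogawski1991.DoubledWeilRepresentationArchVacuum       -- ★ `frameD` (the scaled Folland frame of the doubled archimedean space)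
import HarnessLib

/-!
# Crux `HLiu418`, FACE-G organ (G-gen), road (E), B3-b FILE 1: THE TUPLE CURRENCY — a tuple of one-place Fock polynomials IS one global Fock polynomial, and its
# reading in the junction frame `𝒥_σ` of ★ J2c is `(e_* B⁻¹(a σ)) ⊠ B⁻¹(rest)`

Cell `hodgecm-mathlib`, crux item hLiu418 = `stmt-HodgeConjecture-24832`; squad K2 ∕ K2Liu, F4 lead K2Liu-p27 (g2); prover LH7-p07 (g2).  DEFINITIONS + KERNEL API
(no instance, no notation, no named-fact hypothesis, no `sorry`); lane `--supports stmt-HodgeConjecture-24832 --as helper`.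

WHY (p27 DESIGN OF RECORD 23:26:22Z + ★ B3-core p863061 `forall_tuple_of_fockLetters`).  B3 runs the place-finset induction on TUPLES `a : Π σ, 𝒫_σ` of one-place Fock
polynomials (`𝒫_σ = MvPolynomial (DPIdx P Q R_σ S_σ) ℂ`, the junction ring of `U(𝔻_σ) × U(V′_σ)`), with the section map `SW σ rest F` read on the global arch datum
`𝔈 f (update rest σ F) = E(𝒥⁻¹(⊠_τ B⁻¹(a τ)) ⊗ f)`.  THIS FILE makes «`⊠_τ B⁻¹(a τ)`» a tree term and proves its one-place reading:
* §1 GENERIC POLYNOMIAL SLOTS (places `Ω`, coordinates `ι × Ω`, per place a slot bijection `Ξ_σ : (A_σ ⊕ (ι × {v ≠ σ})) ≃ ι × Ω` whose `inl`-block lies over `σ` and whose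
  `inr`-block is the identity on the other places, and `u_σ : J_σ ≃ A_σ`): `tuplePoly u Ξ a := ∏_σ rename (Ξ_σ ∘ inl ∘ u_σ) (a σ)`, `tupleRest u Ξ σ a` (the polynomial of the
  other places in `σ`'s rest coordinates), **`rename_symm_tuplePoly`** — `rename Ξ_σ⁻¹ (tuplePoly a) = rename inl (rename u_σ (a σ)) * rename inr (tupleRest σ a)`;
  `tupleRest_update` (independent of the `σ`-slot); `tuplePoly_update` ∕ `_add ∕ _smul ∕ _zero ∕ _one` (linear in each slot; all-vacuum tuple `↦ 1`).
* §2 GENERIC SCHWARTZ LEVEL (a Folland frame `e : D ≃L ℝ^{ι × Ω}`): `tupleVecOf e u Ξ a := e^*⁻¹ (B⁻¹ (tuplePoly a))`; **`transport₃_tupleVecOf_eq_tensorPi`** — for ANY three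
  relabellings `ε₁ ε₂ ε₃` with `ε₃ ≫ ε₂ ≫ ε₁ = Ξ_σ`: `T₃(T₂(T₁(e^* tupleVecOf a))) = (relabel_* B⁻¹(a σ)) ⊠ B⁻¹(tupleRest σ a)` (★ `schwartzTransport_relabelCLE_binvPi` ×3, ★
  `binvPi_rename_mul`); linearity in each slot (`tupleVecOf_update_add ∕ _smul ∕ _zero`) and `tupleVecOf (fun _ => 1) = e^*⁻¹ h₀` (the frame Gaussian).
* §3 THE BIG DATUM `𝔻 ⊗ V′` (★ J2c's letters; per real place `σ` of `L⁺` a junction frame `(R_σ, S_σ, eP_σ, eQ_σ)`): `frameSlotEquiv σ` = the composite of J2c's three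
  relabellings at `σ`, `frameSlot σ`, and **`frame_tupleVec_eq_tensorPi`**: with `𝒥_σ` = J2c's frame chain VERBATIM and `e_* = schwartzTransport (reindexCLE (unitJunctionIdx _ _)⁻¹)`,
  `𝒥_σ (tupleVecOf frameD … a) = (e_* B⁻¹(a σ)) ⊠ B⁻¹(tupleRest σ a)` — the `ha` hypothesis of ★ J2c ∕ ★ (P-arch) `K2LiuArchRightLegPlacePin` ∕ ★ (W4) for tuple data, BY NAME.
CONSUMERS: B3-b FILE 2 `K2LiuArchSWDataInduction` (LH7-p07: `SW σ rest`, `Good_f`), FILE 3 `K2LiuArchSWDataFinalPassage` (K2E3-p23 (g8)), §2 letters `K2LiuArchSWPlaceTransport`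
(K2Liu-p05 (g8)).  References: [Folland1989] §1.6 (1.63)–(1.68), §1.7 (1.81); [Weil1964] Chap. I n° 12 p. 160; [KonnoKonno2007] §3.1, §3.3; [Howe1989Remarks] §3.
HONEST LABEL.  Count-neutral helper: `HC_CM` is proved only modulo the 7 printed citations (2 remaining named inputs: hLiu418 = `stmt-HodgeConjecture-24832`,
h413 = `stmt-HodgeConjecture-24833`) until rung 0 closes; this file closes no socket.
-/

set_option autoImplicit false
set_option linter.dupNamespace false -- the mandated namespace repeats `HodgeConjecture.HodgeConjecture`

noncomputable section

open scoped Classical Matrix TensorProduct Kronecker SchwartzMap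
open MvPolynomial
open NumberField NumberField.InfinitePlace NumberField.mixedEmbedding IsDedekindDomain
open Literature.Analysis.SegalBargmann Literature.RepresentationTheory.HeisenbergGroup
open Literature.NumberTheory.Automorphic Literature.NumberTheory.Automorphic.UnitaryGroup Literature.NumberTheory.GaloisRepresentations
open Literature.NumberTheory.Weil1964 Literature.NumberTheory.Weil1964.MpS Literature.NumberTheory.Weil1964.UnitaryWeil
open Literature.RepresentationTheory.HarrisKudlaSweet1996
open Literature.RepresentationTheory.KonnoKonno2007 Literature.RepresentationTheory.KonnoKonno2007.RealDualPair
open Literature.NumberTheory.GelbartRogawski1991 Literature.NumberTheory.GelbartRogawski1991.GRConstruction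
open Literature.NumberTheory.GelbartRogawski1991.UnitaryDualPair
open Literature.NumberTheory.GelbartRogawski1991.UnitaryDualPair.LocalSplitting
open Literature.NumberTheory.K2Lit.SiegelDoubled
open Summit.HodgeConjecture.HodgeConjecture.Cruxes.HLiu418.K2LiuArchSectionPlaceBlock

namespace Summit.HodgeConjecture.HodgeConjecture.Cruxes.HLiu418.K2LiuArchSWDataTuplesDefs

/-! ## §1 Generic polynomial slots -/

section PolySlots

variable {Ω : Type*} [Fintype Ω] {ι : Type*} {J A : Ω → Type*}
  (u : (σ : Ω) → J σ ≃ A σ) (Ξ : (σ : Ω) → (A σ ⊕ (ι × {v : Ω // v ≠ σ})) ≃ (ι × Ω))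

/-- **THE GLOBAL FOCK POLYNOMIAL OF A TUPLE**: `tuplePoly a = ∏_σ (a σ)(z_{Ξ_σ(inl (u_σ ·))})` — each one-place polynomial `a σ ∈ ℂ[J_σ]` is planted in the `σ`-slot of
the global coordinates `ι × Ω`. [cite: Folland1989, §1.7 (1.81)] [cite: Howe1989Remarks, §3] -/
def tuplePoly (a : (σ : Ω) → MvPolynomial (J σ) ℂ) : MvPolynomial (ι × Ω) ℂ :=
  ∏ σ, rename (fun j => Ξ σ (Sum.inl (u σ j))) (a σ)

/-- **THE REST POLYNOMIAL AT `σ`**: the product of the other places' polynomials, read in `σ`'s rest coordinates `ι × {v ≠ σ}`. [cite: Folland1989, §1.7 (1.81)] -/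
def tupleRest (σ : Ω) (a : (τ : Ω) → MvPolynomial (J τ) ℂ) : MvPolynomial (ι × {v : Ω // v ≠ σ}) ℂ :=
  ∏ τ : {τ : Ω // τ ≠ σ}, rename (fun j => ((Ξ τ.1 (Sum.inl (u τ.1 j))).1, ⟨τ.1, τ.2⟩)) (a τ.1)

/-- **THE ALL-VACUUM TUPLE**: `tuplePoly (fun _ => 1) = 1`. [folklore] -/
theorem tuplePoly_one : tuplePoly u Ξ (fun _ => (1 : MvPolynomial (J _) ℂ)) = 1 :=
  Finset.prod_eq_one fun σ _ => by rw [map_one]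

variable [DecidableEq Ω] (hinl : ∀ (τ : Ω) (z : A τ), (Ξ τ (Sum.inl z)).2 = τ) (hinr : ∀ (σ : Ω) (x : ι × {v : Ω // v ≠ σ}), Ξ σ (Sum.inr x) = (x.1, x.2.1))

omit [Fintype Ω] [DecidableEq Ω] in
include hinl hinr in
/-- a slot of ANOTHER place lies in `σ`'s rest block: `Ξ_σ⁻¹ (Ξ_τ (inl z)) = inr ((Ξ_τ (inl z)).1, τ)`. [folklore] -/
theorem symm_apply_slot_of_ne (σ τ : Ω) (hτ : τ ≠ σ) (z : A τ) :
    (Ξ σ).symm (Ξ τ (Sum.inl z)) = Sum.inr ((Ξ τ (Sum.inl z)).1, ⟨τ, hτ⟩) := by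
  rw [Equiv.symm_apply_eq, hinr]
  exact Prod.ext rfl (hinl τ z)

include hinl hinr in
/-- **THE `σ`-SLOT SPLIT**: `rename Ξ_σ⁻¹ (tuplePoly a) = rename inl (rename u_σ (a σ)) * rename inr (tupleRest σ a)`. [cite: Folland1989, §1.7 (1.81)] -/
theorem rename_symm_tuplePoly (σ : Ω) (a : (τ : Ω) → MvPolynomial (J τ) ℂ) :
    rename (Ξ σ).symm (tuplePoly u Ξ a) =
      rename (Sum.inl : A σ → A σ ⊕ (ι × {v : Ω // v ≠ σ})) (rename (u σ) (a σ)) * rename Sum.inr (tupleRest u Ξ σ a) := by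
  rw [tuplePoly, map_prod, ← Finset.mul_prod_erase Finset.univ _ (Finset.mem_univ σ)]
  congr 1
  · rw [rename_rename, rename_rename]
    exact congrArg (fun g => rename g (a σ)) (funext fun j => (Ξ σ).symm_apply_apply _)
  · rw [tupleRest, map_prod, Finset.prod_subtype (Finset.univ.erase σ) (p := fun τ => τ ≠ σ) (fun τ => by simp)]
    refine Finset.prod_congr rfl fun τ _ => ?_
    rw [rename_rename, rename_rename]
    exact congrArg (fun g => rename g (a τ.1)) (funext fun j => symm_apply_slot_of_ne Ξ hinl hinr σ τ.1 τ.2 _)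

/-- the rest polynomial does not see the `σ`-slot. [folklore] -/
theorem tupleRest_update (σ : Ω) (a : (τ : Ω) → MvPolynomial (J τ) ℂ) (F : MvPolynomial (J σ) ℂ) :
    tupleRest u Ξ σ (Function.update a σ F) = tupleRest u Ξ σ a := by
  unfold tupleRest
  exact Finset.prod_congr rfl fun τ _ => by rw [Function.update_of_ne τ.2]

/-- **THE `σ`-SLOT IS A FACTOR**: `tuplePoly (update a σ F) = rename (slot σ) F * ∏_{τ ≠ σ} rename (slot τ) (a τ)`. [folklore] -/
theorem tuplePoly_update (σ : Ω) (a : (τ : Ω) → MvPolynomial (J τ) ℂ) (F : MvPolynomial (J σ) ℂ) :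
    tuplePoly u Ξ (Function.update a σ F) =
      rename (fun j => Ξ σ (Sum.inl (u σ j))) F * ∏ τ ∈ Finset.univ.erase σ, rename (fun j => Ξ τ (Sum.inl (u τ j))) (a τ) := by
  rw [tuplePoly, ← Finset.mul_prod_erase Finset.univ _ (Finset.mem_univ σ), Function.update_self]
  congr 1
  exact Finset.prod_congr rfl fun τ hτ => by rw [Function.update_of_ne (Finset.ne_of_mem_erase hτ)]

/-- linearity of the `σ`-slot: `+`. [folklore] -/
theorem tuplePoly_update_add (σ : Ω) (a : (τ : Ω) → MvPolynomial (J τ) ℂ) (F G : MvPolynomial (J σ) ℂ) :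
    tuplePoly u Ξ (Function.update a σ (F + G)) = tuplePoly u Ξ (Function.update a σ F) + tuplePoly u Ξ (Function.update a σ G) := by
  rw [tuplePoly_update, tuplePoly_update, tuplePoly_update, map_add, add_mul]

/-- linearity of the `σ`-slot: scalars. [folklore] -/
theorem tuplePoly_update_smul (σ : Ω) (a : (τ : Ω) → MvPolynomial (J τ) ℂ) (c : ℂ) (F : MvPolynomial (J σ) ℂ) :
    tuplePoly u Ξ (Function.update a σ (c • F)) = c • tuplePoly u Ξ (Function.update a σ F) := by
  rw [tuplePoly_update, tuplePoly_update, MvPolynomial.smul_eq_C_mul, map_mul, rename_C, ← MvPolynomial.smul_eq_C_mul, smul_mul_assoc]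

/-- the zero slot. [folklore] -/
theorem tuplePoly_update_zero (σ : Ω) (a : (τ : Ω) → MvPolynomial (J τ) ℂ) : tuplePoly u Ξ (Function.update a σ 0) = 0 := by
  rw [tuplePoly_update, map_zero, zero_mul]

end PolySlots

/-! ## §2 Generic Schwartz level: the tuple vector of a Folland frame and its reading through three relabellings -/

section Schwartz

variable {Ω : Type*} [Fintype Ω] [DecidableEq Ω] {ι : Type*} [Fintype ι] [DecidableEq ι] {J A : Ω → Type*}
  (u : (σ : Ω) → J σ ≃ A σ) (Ξ : (σ : Ω) → (A σ ⊕ (ι × {v : Ω // v ≠ σ})) ≃ (ι × Ω))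
  {D : Type*} [NormedAddCommGroup D] [NormedSpace ℝ D] (e : D ≃L[ℝ] ((ι × Ω) → ℝ))

/-- **THE TUPLE VECTOR in a Folland frame `e`**: `tupleVecOf e a = e^*⁻¹ (B⁻¹ (tuplePoly a))` — the polynomial × Gaussian vector of the global Fock polynomial of the
tuple (`B⁻¹ = binvPi`; for the all-vacuum tuple this is the frame Gaussian `follandHermite e 0`). [cite: Folland1989, §1.7 (1.81), §4.2 Prop. (4.39)] -/
def tupleVecOf (a : (σ : Ω) → MvPolynomial (J σ) ℂ) : 𝓢(D, ℂ) :=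
  (schwartzTransport e).symm (binvPi (tuplePoly u Ξ a))

/-- unfolding. [folklore] -/
theorem schwartzTransport_tupleVecOf (a : (σ : Ω) → MvPolynomial (J σ) ℂ) :
    schwartzTransport e (tupleVecOf u Ξ e a) = binvPi (tuplePoly u Ξ a) := by
  rw [tupleVecOf, ContinuousLinearEquiv.apply_symm_apply]

/-- `B⁻¹` along a coordinate permutation: `(reindexCLE ε)_* (B⁻¹F) = B⁻¹ (rename ε⁻¹ F)` (★ `schwartzTransport_relabelCLE_binvPi` at `ε⁻¹`). [cite: Folland1989, §1.7] -/
theorem schwartzTransport_reindexCLE_binvPi {σ σ' : Type*} [Fintype σ] [DecidableEq σ] [Fintype σ'] [DecidableEq σ'] (ε : σ ≃ σ')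
    (F : MvPolynomial σ' ℂ) : schwartzTransport (reindexCLE ε) (binvPi F) = binvPi (rename ε.symm F) :=
  schwartzTransport_relabelCLE_binvPi ε.symm F

/-- **THE READING THROUGH THREE RELABELLINGS** (the shape of ★ J2c's frame chain `𝒥_σ = e_* ≫ T₁ ≫ T₂ ≫ T₃`): if `ε₃ ≫ ε₂ ≫ ε₁ = Ξ_σ` then
`T₃(T₂(T₁(e_* tupleVecOf a))) = (inl-relabel of B⁻¹(rename u_σ (a σ))) ⊠ B⁻¹(tupleRest σ a)` — i.e. `(u_σ-relabel_* B⁻¹(a σ)) ⊠ B⁻¹(rest)`.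
[cite: Folland1989, §1.6 (1.63)–(1.68), §1.7 (1.81)] [cite: Weil1964, Chap. I n° 12 p. 160] -/
theorem transport₃_tupleVecOf_eq_tensorPi [∀ σ, Fintype (J σ)] [∀ σ, DecidableEq (J σ)] [∀ σ, Fintype (A σ)] [∀ σ, DecidableEq (A σ)]
    (hinl : ∀ (τ : Ω) (z : A τ), (Ξ τ (Sum.inl z)).2 = τ) (hinr : ∀ (σ : Ω) (x : ι × {v : Ω // v ≠ σ}), Ξ σ (Sum.inr x) = (x.1, x.2.1))
    (σ : Ω) {X₁ X₂ : Type*} [Fintype X₁] [DecidableEq X₁] [Fintype X₂] [DecidableEq X₂]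
    (ε₁ : X₁ ≃ (ι × Ω)) (ε₂ : X₂ ≃ X₁) (ε₃ : (A σ ⊕ (ι × {v : Ω // v ≠ σ})) ≃ X₂) (hε : ε₃.trans (ε₂.trans ε₁) = Ξ σ)
    (a : (τ : Ω) → MvPolynomial (J τ) ℂ) :
    schwartzTransport (reindexCLE ε₃) (schwartzTransport (reindexCLE ε₂) (schwartzTransport (reindexCLE ε₁) (schwartzTransport e (tupleVecOf u Ξ e a)))) =
      tensorPi (schwartzTransport (reindexCLE (u σ).symm) (binvPi (a σ))) (binvPi (tupleRest u Ξ σ a)) := by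
  rw [schwartzTransport_tupleVecOf, schwartzTransport_reindexCLE_binvPi, schwartzTransport_reindexCLE_binvPi, schwartzTransport_reindexCLE_binvPi,
    schwartzTransport_reindexCLE_binvPi, rename_rename, rename_rename, Equiv.symm_symm]
  have hcomp : ((⇑ε₃.symm ∘ ⇑ε₂.symm) ∘ ⇑ε₁.symm : ι × Ω → A σ ⊕ (ι × {v : Ω // v ≠ σ})) = ⇑(Ξ σ).symm := by
    rw [← hε]; rfl
  rw [hcomp, rename_symm_tuplePoly u Ξ hinl hinr σ a, binvPi_rename_mul]

/-- linearity of the `σ`-slot of the tuple vector: `+`. [folklore] -/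
theorem tupleVecOf_update_add (σ : Ω) (a : (τ : Ω) → MvPolynomial (J τ) ℂ) (F G : MvPolynomial (J σ) ℂ) :
    tupleVecOf u Ξ e (Function.update a σ (F + G)) = tupleVecOf u Ξ e (Function.update a σ F) + tupleVecOf u Ξ e (Function.update a σ G) := by
  rw [tupleVecOf, tupleVecOf, tupleVecOf, tuplePoly_update_add, binvPi_add, map_add]

/-- linearity of the `σ`-slot of the tuple vector: scalars. [folklore] -/
theorem tupleVecOf_update_smul (σ : Ω) (a : (τ : Ω) → MvPolynomial (J τ) ℂ) (c : ℂ) (F : MvPolynomial (J σ) ℂ) :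
    tupleVecOf u Ξ e (Function.update a σ (c • F)) = c • tupleVecOf u Ξ e (Function.update a σ F) := by
  rw [tupleVecOf, tupleVecOf, tuplePoly_update_smul, binvPi_smul, map_smul]

/-- the zero slot gives the zero vector. [folklore] -/
theorem tupleVecOf_update_zero (σ : Ω) (a : (τ : Ω) → MvPolynomial (J τ) ℂ) : tupleVecOf u Ξ e (Function.update a σ 0) = 0 := by
  rw [tupleVecOf, tuplePoly_update_zero, ← binvPiₗ_apply, map_zero, map_zero]

/-- `ζ_0 = 1` (the vacuum symbol). [folklore] -/
theorem zeta_zero_eq_one {σ : Type*} [Fintype σ] [DecidableEq σ] : (zeta (0 : σ →₀ ℕ) : MvPolynomial σ ℂ) = 1 := by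
  have h : (hcoef (0 : σ →₀ ℕ) : ℝ) = 1 := by
    rw [hcoef, mdeg, mfact]
    simp
  rw [zeta, h, Complex.ofReal_one, one_smul, MvPolynomial.monomial_zero', map_one]

/-- **THE ALL-VACUUM TUPLE IS THE FRAME GAUSSIAN**: `tupleVecOf e (fun _ => 1) = e^*⁻¹ h₀` (`= follandHermite e 0`). [cite: Folland1989, §4.2 Prop. (4.39)] -/
theorem tupleVecOf_one : tupleVecOf u Ξ e (fun _ => (1 : MvPolynomial (J _) ℂ)) = (schwartzTransport e).symm (hermitePi 0) := by
  rw [tupleVecOf, tuplePoly_one, ← zeta_zero_eq_one, binvPi_zeta]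

end Schwartz


/-! ## §3 The BIG datum `𝔻 ⊗ V′`: J2c's junction frames at every real place, and the reading of a tuple vector -/

section BigDatum

variable (L : Type) [Field L] [NumberField L] [IsCMField L]
variable {N M n : ℕ} (e : Fin N × Fin M ≃ Fin n)
  (dV : Fin N → L) (hdV : ∀ i, IsCMField.complexConj L (dV i) = dV i) (hdV0 : ∀ i, dV i ≠ 0)
  (dW : Fin M → L) (hdW : ∀ i, IsCMField.complexConj L (dW i) = dW i) (hdW0 : ∀ i, dW i ≠ 0)
variable {M₂ M' n' : ℕ} (eW : Fin M × Fin M₂ ≃ Fin M') (e' : Fin N × Fin M' ≃ Fin n')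
  (dV' : Fin M₂ → L) (hdV' : ∀ k, IsCMField.complexConj L (dV' k) = dV' k) (hdV'0 : ∀ k, dV' k ≠ 0)
  {P Q : Type} [Fintype P] [DecidableEq P] [Fintype Q] [DecidableEq Q]
  (R S : {v : InfinitePlace (Fp L) // v.IsReal} → Type) [∀ σ, Fintype (R σ)] [∀ σ, DecidableEq (R σ)] [∀ σ, Fintype (S σ)] [∀ σ, DecidableEq (S σ)]
  (eP : ∀ σ : {v : InfinitePlace (Fp L) // v.IsReal}, PosIdx (signVec (cmPlaceOver L) (fun k => Sum.elim (cmGramEntry L e' dV hdV (tensorFrame L dW eW dV') (tensorFrame_real L dW hdW eW dV' hdV')) (-cmGramEntry L e' dV hdV (tensorFrame L dW eW dV') (tensorFrame_real L dW hdW eW dV' hdV')) ((LocalSplitting.e₂ n').symm k)) (imagUnit L) σ) ≃ (P × R σ) ⊕ (Q × S σ))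
  (eQ : ∀ σ : {v : InfinitePlace (Fp L) // v.IsReal}, NegIdx (signVec (cmPlaceOver L) (fun k => Sum.elim (cmGramEntry L e' dV hdV (tensorFrame L dW eW dV') (tensorFrame_real L dW hdW eW dV' hdV')) (-cmGramEntry L e' dV hdV (tensorFrame L dW eW dV') (tensorFrame_real L dW hdW eW dV' hdV')) ((LocalSplitting.e₂ n').symm k)) (imagUnit L) σ) ≃ (P × S σ) ⊕ (Q × R σ))

/-- **J2c's THREE RELABELLINGS AT `σ`, COMPOSED** (block types `eP_σ eQ_σ`, then the junction index, then the split of the place frame at `σ`):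
`(DPIdx_𝕎,σ 1 ∅ ⊕ (ι × {v ≠ σ})) ≃ ι × Ω`, `ι = Fin (n′+n′)`, `Ω` = the real places of `L⁺`. [cite: Weil1964, Chap. I n° 12 p. 160] [cite: KonnoKonno2007, §3.1] -/
def frameSlotEquiv (σ : {v : InfinitePlace (Fp L) // v.IsReal}) :
    (DPIdx ((P × R σ) ⊕ (Q × S σ)) ((P × S σ) ⊕ (Q × R σ)) Unit Empty ⊕ (Fin (n' + n') × {v : {v : InfinitePlace (Fp L) // v.IsReal} // v ≠ σ})) ≃
      (Fin (n' + n') × {v : InfinitePlace (Fp L) // v.IsReal}) :=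
  (Equiv.sumCongr
      (dpIdxCongr (PosIdx (signVec (cmPlaceOver L) (fun k => Sum.elim (cmGramEntry L e' dV hdV (tensorFrame L dW eW dV') (tensorFrame_real L dW hdW eW dV' hdV')) (-cmGramEntry L e' dV hdV (tensorFrame L dW eW dV') (tensorFrame_real L dW hdW eW dV' hdV')) ((LocalSplitting.e₂ n').symm k)) (imagUnit L) σ)) (NegIdx (signVec (cmPlaceOver L) (fun k => Sum.elim (cmGramEntry L e' dV hdV (tensorFrame L dW eW dV') (tensorFrame_real L dW hdW eW dV' hdV')) (-cmGramEntry L e' dV hdV (tensorFrame L dW eW dV') (tensorFrame_real L dW hdW eW dV' hdV')) ((LocalSplitting.e₂ n').symm k)) (imagUnit L) σ)) Unit Empty ((P × R σ) ⊕ (Q × S σ)) ((P × S σ) ⊕ (Q × R σ)) Unit Empty (eP σ) (eQ σ) (Equiv.refl Unit)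
        (Equiv.refl Empty)).symm
      (Equiv.refl (Fin (n' + n') × {v : {v : InfinitePlace (Fp L) // v.IsReal} // v ≠ σ}))).trans
    ((Equiv.sumCongr (unitJunctionIdx (PosIdx (signVec (cmPlaceOver L) (fun k => Sum.elim (cmGramEntry L e' dV hdV (tensorFrame L dW eW dV') (tensorFrame_real L dW hdW eW dV' hdV')) (-cmGramEntry L e' dV hdV (tensorFrame L dW eW dV') (tensorFrame_real L dW hdW eW dV' hdV')) ((LocalSplitting.e₂ n').symm k)) (imagUnit L) σ)) (NegIdx (signVec (cmPlaceOver L) (fun k => Sum.elim (cmGramEntry L e' dV hdV (tensorFrame L dW eW dV') (tensorFrame_real L dW hdW eW dV' hdV')) (-cmGramEntry L e' dV hdV (tensorFrame L dW eW dV') (tensorFrame_real L dW hdW eW dV' hdV')) ((LocalSplitting.e₂ n').symm k)) (imagUnit L) σ))).symm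
        (Equiv.refl (Fin (n' + n') × {v : {v : InfinitePlace (Fp L) // v.IsReal} // v ≠ σ}))).trans
      (placeSplitEquiv (signSplit (signVec (cmPlaceOver L) (fun k => Sum.elim (cmGramEntry L e' dV hdV (tensorFrame L dW eW dV') (tensorFrame_real L dW hdW eW dV' hdV')) (-cmGramEntry L e' dV hdV (tensorFrame L dW eW dV') (tensorFrame_real L dW hdW eW dV' hdV')) ((LocalSplitting.e₂ n').symm k)) (imagUnit L) σ)) σ))

omit [Fintype P] [DecidableEq P] [Fintype Q] [DecidableEq Q] [∀ σ, Fintype (R σ)] [∀ σ, DecidableEq (R σ)] [∀ σ, Fintype (S σ)] [∀ σ, DecidableEq (S σ)] in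
/-- the `inl`-block of `frameSlotEquiv σ` lies over the place `σ`. [cite: Weil1964, Chap. I n° 12 p. 160] -/
theorem frameSlotEquiv_inl_snd (τ : {v : InfinitePlace (Fp L) // v.IsReal}) (z : DPIdx ((P × R τ) ⊕ (Q × S τ)) ((P × S τ) ⊕ (Q × R τ)) Unit Empty) :
    (frameSlotEquiv L dV hdV dW hdW eW e' dV' hdV' R S eP eQ τ (Sum.inl z)).2 = τ := by
  simp only [frameSlotEquiv, Equiv.trans_apply, Equiv.sumCongr_apply, Sum.map_inl]
  rfl

omit [Fintype P] [DecidableEq P] [Fintype Q] [DecidableEq Q] [∀ σ, Fintype (R σ)] [∀ σ, DecidableEq (R σ)] [∀ σ, Fintype (S σ)] [∀ σ, DecidableEq (S σ)] in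
/-- the `inr`-block of `frameSlotEquiv σ` is the identity on the other places. [cite: Weil1964, Chap. I n° 12 p. 160] -/
theorem frameSlotEquiv_inr (σ : {v : InfinitePlace (Fp L) // v.IsReal}) (x : Fin (n' + n') × {v : {v : InfinitePlace (Fp L) // v.IsReal} // v ≠ σ}) :
    frameSlotEquiv L dV hdV dW hdW eW e' dV' hdV' R S eP eQ σ (Sum.inr x) = (x.1, x.2.1) := by
  simp only [frameSlotEquiv, Equiv.trans_apply, Equiv.sumCongr_apply, Sum.map_inr, Equiv.refl_apply]
  rfl

/-- **THE TUPLE VECTOR OF THE BIG DATUM**: `tupleVec a := tupleVecOf frameD a` — the polynomial × Gaussian vector of `𝓢((L⁺ ⊗ ℝ)^{n′+n′})` whose `σ`-slot is the one-place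
Fock polynomial `a σ ∈ ℂ[DPIdx P Q R_σ S_σ]` at every real place `σ` (the all-vacuum tuple gives ★ `archGaussianOfRecord` = `follandHermite frameD 0`).
[cite: Folland1989, §1.7 (1.81), §4.2 Prop. (4.39)] [cite: Howe1989Remarks, §3] -/
def tupleVec (a : (σ : {v : InfinitePlace (Fp L) // v.IsReal}) → MvPolynomial (DPIdx P Q (R σ) (S σ)) ℂ) :
    𝓢((Fin (n' + n') → mixedSpace (Fp L)), ℂ) :=
  tupleVecOf (fun σ => unitJunctionIdx ((P × R σ) ⊕ (Q × S σ)) ((P × S σ) ⊕ (Q × R σ)))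
    (frameSlotEquiv L dV hdV dW hdW eW e' dV' hdV' R S eP eQ) (frameD L e' dV hdV hdV0 (tensorFrame L dW eW dV') (tensorFrame_real L dW hdW eW dV' hdV') (tensorFrame_ne_zero L dW eW dV' hdW0 hdV'0)) a

-- the CM sign frame and the three relabellings elaborate slowly (as ★ J2c: 4 000 000 heartbeats for the statement)
set_option maxHeartbeats 4000000 in
/-- **THE READING OF A TUPLE VECTOR IN J2c's JUNCTION FRAME AT `σ`** — the `ha` hypothesis of ★ J2c `exists_clm_swSectionTensor_mul_oneplace_eq`, ★ (P-arch)
`K2LiuArchRightLegPlacePin.exists_clm_swSection_mul_placeSecJ_pair_eq` and ★ (W4) for tuple data: `𝒥_σ (tupleVec a) = (e_* B⁻¹(a σ)) ⊠ B⁻¹(tupleRest σ a)`,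
`e_* = schwartzTransport (reindexCLE (unitJunctionIdx _ _)⁻¹)`. [cite: Folland1989, §1.6 (1.63)–(1.68), §1.7 (1.81)] [cite: Weil1964, Chap. I n° 12 p. 160] -/
theorem frame_tupleVec_eq_tensorPi (σ : {v : InfinitePlace (Fp L) // v.IsReal})
    (a : (τ : {v : InfinitePlace (Fp L) // v.IsReal}) → MvPolynomial (DPIdx P Q (R τ) (S τ)) ℂ) :
        ((((schwartzTransport
                  (scaledFrame (Fp L) (Fin (n' + n'))
                    (placeScale (n' + n') fun v => sqrtAbs (signVec (cmPlaceOver L)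
                      (fun k => Sum.elim (cmGramEntry L e' dV hdV (tensorFrame L dW eW dV') (tensorFrame_real L dW hdW eW dV' hdV')) (-cmGramEntry L e' dV hdV (tensorFrame L dW eW dV') (tensorFrame_real L dW hdW eW dV' hdV')) ((LocalSplitting.e₂ n').symm k))
                      (imagUnit L) v))
                    (placeScale_ne_zero (n' + n') (sqrtAbs_signVec_ne_zero (IsCMField.complexConj_ne_one L) (cmPlaceOver_smul L)
                      (complexConj_imagUnit L) (imagUnit_ne_zero L) (gramD_gram_realDiagonal_entry_ne_zero L e' dV hdV (tensorFrame L dW eW dV') (tensorFrame_real L dW hdW eW dV' hdV') hdV0 (tensorFrame_ne_zero L dW eW dV' hdW0 hdV'0)))))).trans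
                (schwartzTransport (reindexCLE (placeSplitEquiv (signSplit (signVec (cmPlaceOver L)
                  (fun k => Sum.elim (cmGramEntry L e' dV hdV (tensorFrame L dW eW dV') (tensorFrame_real L dW hdW eW dV' hdV')) (-cmGramEntry L e' dV hdV (tensorFrame L dW eW dV') (tensorFrame_real L dW hdW eW dV' hdV')) ((LocalSplitting.e₂ n').symm k))
                  (imagUnit L) σ)) σ)))).trans
                (schwartzTransport (reindexCLE (Equiv.sumCongr
                  (unitJunctionIdx
                    (PosIdx (signVec (cmPlaceOver L)
                      (fun k => Sum.elim (cmGramEntry L e' dV hdV (tensorFrame L dW eW dV') (tensorFrame_real L dW hdW eW dV' hdV')) (-cmGramEntry L e' dV hdV (tensorFrame L dW eW dV') (tensorFrame_real L dW hdW eW dV' hdV')) ((LocalSplitting.e₂ n').symm k))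
                      (imagUnit L) σ))
                    (NegIdx (signVec (cmPlaceOver L)
                      (fun k => Sum.elim (cmGramEntry L e' dV hdV (tensorFrame L dW eW dV') (tensorFrame_real L dW hdW eW dV' hdV')) (-cmGramEntry L e' dV hdV (tensorFrame L dW eW dV') (tensorFrame_real L dW hdW eW dV' hdV')) ((LocalSplitting.e₂ n').symm k))
                      (imagUnit L) σ))).symm
                  (Equiv.refl (Fin (n' + n') × {v : {v : InfinitePlace (Fp L) // v.IsReal} // v ≠ σ})))))).trans
                (schwartzTransport (reindexCLE (Equiv.sumCongr
                  (dpIdxCongr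
                    (PosIdx (signVec (cmPlaceOver L)
                      (fun k => Sum.elim (cmGramEntry L e' dV hdV (tensorFrame L dW eW dV') (tensorFrame_real L dW hdW eW dV' hdV')) (-cmGramEntry L e' dV hdV (tensorFrame L dW eW dV') (tensorFrame_real L dW hdW eW dV' hdV')) ((LocalSplitting.e₂ n').symm k))
                      (imagUnit L) σ))
                    (NegIdx (signVec (cmPlaceOver L)
                      (fun k => Sum.elim (cmGramEntry L e' dV hdV (tensorFrame L dW eW dV') (tensorFrame_real L dW hdW eW dV' hdV')) (-cmGramEntry L e' dV hdV (tensorFrame L dW eW dV') (tensorFrame_real L dW hdW eW dV' hdV')) ((LocalSplitting.e₂ n').symm k))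
                      (imagUnit L) σ))
                    Unit Empty ((P × R σ) ⊕ (Q × S σ)) ((P × S σ) ⊕ (Q × R σ)) Unit Empty (eP σ) (eQ σ) (Equiv.refl Unit) (Equiv.refl Empty)).symm
                  (Equiv.refl (Fin (n' + n') × {v : {v : InfinitePlace (Fp L) // v.IsReal} // v ≠ σ})))))) (tupleVec L dV hdV hdV0 dW hdW hdW0 eW e' dV' hdV' hdV'0 R S eP eQ a) =
      tensorPi (schwartzTransport (reindexCLE (unitJunctionIdx ((P × R σ) ⊕ (Q × S σ)) ((P × S σ) ⊕ (Q × R σ))).symm) (binvPi (a σ)))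
        (binvPi (tupleRest (fun τ => unitJunctionIdx ((P × R τ) ⊕ (Q × S τ)) ((P × S τ) ⊕ (Q × R τ)))
          (frameSlotEquiv L dV hdV dW hdW eW e' dV' hdV' R S eP eQ) σ a)) :=
  transport₃_tupleVecOf_eq_tensorPi (fun τ => unitJunctionIdx ((P × R τ) ⊕ (Q × S τ)) ((P × S τ) ⊕ (Q × R τ)))
    (frameSlotEquiv L dV hdV dW hdW eW e' dV' hdV' R S eP eQ) (frameD L e' dV hdV hdV0 (tensorFrame L dW eW dV') (tensorFrame_real L dW hdW eW dV' hdV') (tensorFrame_ne_zero L dW eW dV' hdW0 hdV'0))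
    (frameSlotEquiv_inl_snd L dV hdV dW hdW eW e' dV' hdV' R S eP eQ)
    (frameSlotEquiv_inr L dV hdV dW hdW eW e' dV' hdV' R S eP eQ) σ _ _ _ rfl a

end BigDatum

end Summit.HodgeConjecture.HodgeConjecture.Cruxes.HLiu418.K2LiuArchSWDataTuplesDefs

end
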